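import Summits.BirchSwinnertonDyer.BirchSwinnertonDyer.Theorems.GenusKolyvaginAtTwoGenusPrimitiveSupplyAtTwoMultiGenusField
import Literature.NumberTheory.EllipticCurves.HeegnerPointsKolyvaginPrimaryCongruenceProofs
import Literature.NumberTheory.EllipticCurves.HeegnerPointsKolyvaginGoodReductionProofs
import Literature.NumberTheory.EllipticCurves.IsogenyFrobeniusTraceProofs

/-!
# Route `GenusKolyvaginAtTwo`, crux `GenusPrimitiveSupplyAtTwo` (stmt-BirchSwinnertonDyer-22136), line `genus-supply`:
# Gross's Kolyvagin primes at `2` are Zhang's — the dictionary under the STRONG prime predicate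

Lead prover seat bsd-line-gk2-p1 (g2). The crux and the line's dictionary are typed with W. Zhang's predicate
`Zhang2014.IsKolyvaginPrime N_E W K 2 ℓ` («`ℓ ∤ 2 N_E d_K`, inert, `M(ℓ) = min(v₂(ℓ+1), v₂(a_ℓ)) ≥ 1`», i.e. at `p = 2`: `ℓ` odd,
inert, `a_ℓ` even), which at `p = 2` is WEAKER than Gross's (3.1)–(3.2) `IsKolyvaginPrime N_E W K 2 ℓ` («`Frob_ℓ = Frob_∞` in
`Gal(K(E[2])/ℚ)`», tree `FrobEqFrobInfty`; sibling gk2-p2's planning notes on crux 22137 recommend restating the route with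
Gross's form). This file records that Gross's primes ARE Zhang's at `p = 2` (`zhang_isKolyvaginPrime_two_of_isKolyvaginPrime`:
Gross's congruence (3.3) `a_ℓ ≡ ℓ + 1 ≡ 0 (mod p)`, tree `pow_dvd_frobeniusTraceAt_of_frobEqFrobInfty`, good reduction at
`ℓ ∤ N_E` from the modular parametrisation datum), so every theorem of the dictionary — in particular the composite-level
intrinsic form `heegner_exists_two_zsmul_eq_derivedPoint_iff_multiGenusTrace` — holds verbatim under the strong predicate
(`heegner_exists_two_zsmul_eq_derivedPoint_iff_multiGenusTrace_of_gross`): a restatement of the certificate clause of 22136 /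
22137 along Gross's primes costs the line nothing. Helper (`--supports stmt-BirchSwinnertonDyer-22136`). No summit and no leaf is
proved by this file; BSD is not proved by any of this.
-/

set_option linter.dupNamespace false -- tree convention: `Summit.BirchSwinnertonDyer.BirchSwinnertonDyer.Theorems` (summit = sub-problem)

noncomputable section

open scoped Classical

namespace Summit.BirchSwinnertonDyer.BirchSwinnertonDyer.Theorems.GenusKoly

open Finset NumberField WeierstrassCurve Literature.NumberTheory.EllipticCurves
  Literature.NumberTheory.EllipticCurves.ModularForms

variable {W : WeierstrassCurve ℚ} [NeZero (W.conductorNorm ℤ)] {K : Type} [Field K] [NumberField K]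

/-- **Gross's Kolyvagin primes at `2` are Zhang's.** For `E/ℚ` (globally minimal `W`) with a modular parametrisation datum at
level `N_E` and `ℓ` a Kolyvagin prime in Gross's sense for `(E, K, 2)` (`ℓ ∤ 2 N_E d_K`, inert, `Frob_ℓ = Frob_∞` in
`Gal(K(E[2])/ℚ)`): `ℓ` is a Kolyvagin prime in Zhang's sense (`M(ℓ) ≥ 1`, i.e. `2 ∣ ℓ + 1` and `2 ∣ a_ℓ`) — Gross 1991 (3.3)
«`a_ℓ ≡ ℓ + 1 ≡ 0 (mod p)`» (tree `pow_dvd_frobeniusTraceAt_of_frobEqFrobInfty`, with good reduction at `ℓ ∤ N_E` from the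
newform of the datum). [cite: GrossLMS1991, §3 (3.1)–(3.3)] [cite: WZhang2014, Notations (xii)] -/
theorem zhang_isKolyvaginPrime_two_of_isKolyvaginPrime [W.IsElliptic] [W.IsGloballyMinimal]
    (Dt : ModularParametrizationData W (W.conductorNorm ℤ)) {ℓ : ℕ}
    (hℓ : IsKolyvaginPrime (W.conductorNorm ℤ) W K 2 ℓ) : Zhang2014.IsKolyvaginPrime (W.conductorNorm ℤ) W K 2 ℓ := by
  haveI : Fact (Nat.Prime 2) := ⟨Nat.prime_two⟩
  refine ⟨hℓ.1, hℓ.2.1, hℓ.2.2.1, hℓ.2.2.2.1, hℓ.2.2.2.2.1, ?_⟩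
  refine Nat.pos_of_ne_zero fun h0 ↦ ?_
  have h1 : (1 : ℕ) ≤ Zhang2014.kolyvaginIndex W 2 ℓ := by
    refine (Zhang2014.le_kolyvaginIndex_iff (W := W) (p := 2) (M := 1) (ℓ := ℓ)).mpr ⟨?_, ?_⟩
    · rw [pow_one]
      exact even_iff_two_dvd.mp ((hℓ.1.odd_of_ne_two hℓ.2.2.2.1).add_one)
    · -- Gross (3.3): `2 ∣ a_ℓ`
      have hℓv := hℓ.natCast_mem_under
      have hgood : W.HasGoodReductionAt (hℓ.place.under (𝓞 ℚ)) :=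
        hasGoodReductionAt_of_isNewformOf_of_not_dvd W Dt.isNewformOf hℓ.1 hℓ.2.1 _ hℓv
      have h32 : FrobEqFrobInfty W K (2 ^ 1) ℓ := by rw [pow_one]; exact hℓ.2.2.2.2.2
      have h := pow_dvd_frobeniusTraceAt_of_frobEqFrobInfty W (K := K) Nat.prime_two le_rfl hℓ.1 hℓ.2.2.2.1 h32 hℓv hgood
      rw [frobeniusTraceAt_eq_frobeniusTrace, primesEquiv_eq_of_natCast_mem hℓ.1 hℓv] at h
      exact_mod_cast h
  omega

/-- The list form: a square-free level of Gross-Kolyvagin primes at `2` is a level of Zhang-Kolyvagin primes at `2`.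
[cite: GrossLMS1991, §3 (3.1)–(3.3)] -/
theorem forall_zhang_isKolyvaginPrime_two_of_isKolyvaginPrime [W.IsElliptic] [W.IsGloballyMinimal]
    (Dt : ModularParametrizationData W (W.conductorNorm ℤ)) {n : ℕ}
    (hKoly : ∀ ℓ ∈ n.primeFactors, IsKolyvaginPrime (W.conductorNorm ℤ) W K 2 ℓ) :
    ∀ ℓ ∈ n.primeFactors, Zhang2014.IsKolyvaginPrime (W.conductorNorm ℤ) W K 2 ℓ :=
  fun ℓ hℓ ↦ zhang_isKolyvaginPrime_two_of_isKolyvaginPrime Dt (hKoly ℓ hℓ)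

/-- **The composite-level intrinsic dictionary under Gross's prime predicate** (`IsKolyvaginPrime … 2 ℓ`, `Frob_ℓ = Frob_∞`):
`P(n) ∈ 2E(K[n]) ⟺ Σ_{g ∈ Gal(K[n]/K(√ℓ* : ℓ∣n))} g·y(n) ∈ 2E(K[n])`, verbatim as
`heegner_exists_two_zsmul_eq_derivedPoint_iff_multiGenusTrace`. [cite: GrossLMS1991, §3 (3.1)–(3.5), §4 (4.1)] [cite: Cox2013, Thm. 9.18, §9.A] -/
theorem heegner_exists_two_zsmul_eq_derivedPoint_iff_multiGenusTrace_of_gross [W.IsElliptic] [W.IsGloballyMinimal]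
    (hK : IsImaginaryQuadratic K) (hD : NumberField.discr K < -4)
    (hH : SatisfiesHeegnerHypothesis (W.conductorNorm ℤ) K) {n : ℕ} (hn : Squarefree n)
    {Dt : ModularParametrizationData W (W.conductorNorm ℤ)} {β : ℤ} {ι : K →+* ℂ}
    (hKoly : ∀ ℓ ∈ n.primeFactors, IsKolyvaginPrime (W.conductorNorm ℤ) W K 2 ℓ)
    (d : KolyvaginHeegnerData Dt β ι n) {θ : ℕ → ringClassField K ι n}
    (hθ : ∀ ℓ ∈ n.primeFactors, θ ℓ ^ 2 = algebraMap ℚ (ringClassField K ι n) ((-1 : ℚ) ^ (ℓ / 2) * ℓ))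
    (T : Finset (ringClassField K ι n ≃ₐ[ℚ] ringClassField K ι n))
    (hT : ∀ g, g ∈ T ↔ g ∈ ringClassGal ι n ∧ ∀ ℓ ∈ n.primeFactors, g (θ ℓ) = θ ℓ) :
    (∃ Q : (W.baseChange (ringClassField K ι n)).toAffine.Point, (2 : ℤ) • Q = d.derivedPoint) ↔
      ∃ Q : (W.baseChange (ringClassField K ι n)).toAffine.Point, (2 : ℤ) • Q =
        ∑ g ∈ T, pointGalHom W (ringClassField K ι n) g d.y :=
  heegner_exists_two_zsmul_eq_derivedPoint_iff_multiGenusTrace hK hD hH hn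
    (forall_zhang_isKolyvaginPrime_two_of_isKolyvaginPrime Dt hKoly) d hθ T hT

end Summit.BirchSwinnertonDyer.BirchSwinnertonDyer.Theorems.GenusKoly

end
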